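import Literature.NumberTheory.GaloisRepresentations.LocalEulerCharacteristicMu
import Literature.NumberTheory.GaloisRepresentations.LocalFieldFiniteExtensionIntegers
import Literature.NumberTheory.GaloisRepresentations.LocalDualityTheorem
import Literature.NumberTheory.GaloisRepresentations.TateLocalH2Pigeonhole
import HarnessLib

/-!
# The local unit-index formula `(Fˣ : Fˣᴺ) = #μ_N(F) · N · #(𝒪_F / N𝒪_F)` and its monotonicity
# in finite extensions (Neukirch, *ANT* II (5.8); Serre, *Corps locaux* XIV)

Topic `NumberTheory/GaloisRepresentations`; namespace `Literature.NumberTheory.GaloisRepresentations`.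
PROOF-ONLY file (theorems only: no definition, no named fact, no instance).

For a non-archimedean local field `F` of characteristic `0` and `N ≥ 1`, J. Neukirch, *Algebraic
Number Theory* (1999), Ch. II §5, Cor. (5.8), p. 142: "Let `n` be a natural number which is not divisible by
the characteristic of `K` … Then `(K* : K*ⁿ) = n · #μ_n(K) / |n|_𝔭`" (for `μ_n ⊆ K` this is the familiar
`n² / |n|_𝔭`; `|n|_𝔭⁻¹ = (𝒪 : n𝒪)`).  Here it is obtained COHOMOLOGICALLY, from three theorems of the
tree and ONE named fact carried as a hypothesis:

* Kummer theory `H¹(F, μ_N) ≃ Fˣ/Fˣᴺ` (`kummerEquiv`, PROVED);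
* `#H⁰(F, μ_N) = #μ_N(F)` (`natCard_invariants_mu`, PROVED) and `#H²(F, μ_N) = N` (the tree's Brauer-group
  computation `natCard_two_mu_absoluteGaloisGroup_eq`, PROVED — for EVERY `N`, not only prime powers);
* Tate's local Euler–Poincaré characteristic `#H⁰ · #H² · #(𝒪_F/(#M)) = #H¹` — the tree's NAMED FACT
  `localEulerPoincareCharacteristic F` (Milne, *ADT* I Thm. 2.8), carried here as the HYPOTHESIS `hEP`
  (it is PROVED in the tree, but Summits-side: `localEulerPoincareCharacteristic_holds` in
  `Summits/BirchSwinnertonDyer/Rank1Residual/GaloisImage/LocalEulerPoincareCharacteristicHolds.lean`,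
  which a Literature file may not import — exactly the pattern of `LocalGaloisHOneCardBound.lean` and
  `MonoidKummerMapsTLGLiftOfFiniteIndexOpen.lean`; consumers discharge `hEP` Summits-side).

Results:

* `natCard_units_quot_range_pow_eq_of_localEP` — **`#(Fˣ/Fˣᴺ) = #μ_N(F) · N · #(𝒪[F] ⧸ N)`**;
* `natCard_rootsOfUnity_le_of_le`, `natCard_integer_quot_le_of_le` — for finite subextensions
  `E ≤ M` of `K̄/K` (`K` a non-archimedean local field of characteristic `0`, `E`, `M` with the extended
  valuations `FiniteExtension.valuativeRel K _`): `#μ_N(E) ≤ #μ_N(M)` and `#(𝒪[E] ⧸ N) ≤ #(𝒪[M] ⧸ N)`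
  (the latter because `𝒪[E] = 𝒪[M] ∩ E`, both being the `𝒪[K]`-integral elements,
  `FiniteExtension.mem_integer_iff_isIntegral`);
* `natCard_units_quot_range_pow_le_of_le` — **monotonicity `#(Eˣ/Eˣᴺ) ≤ #(Mˣ/Mˣᴺ)` for `E ≤ M`**
  (an instance-free statement about the fields `E`, `M`; `hEP` for all `p`-adic fields is the only
  hypothesis).  This inequality is the number-theoretic input of [FrdII] Remark 2.2.1 in the general case
  (cell abc-iut, FACT-LIST row F-1198, GAP-2R; consumer `PadicKummerRemark221General.lean`).

## References
* J. Neukirch, *Algebraic Number Theory*, Springer 1999, Ch. II §5 Prop. (5.7), Cor. (5.8). [NeukirchANT1999]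
* J.-P. Serre, *Corps locaux*, Hermann 1968, Ch. XIV §1–§3. [SerreLocalFields1979]
* J. S. Milne, *Arithmetic Duality Theorems*, 2nd ed. 2006, I Thm. 2.8. [MilneADT2006]
-/

noncomputable section

open CategoryTheory Function
open Field IsNonarchimedeanLocalField ValuativeRel IntermediateField

namespace Literature.NumberTheory.GaloisRepresentations

open _root_.TopRep _root_.ContRepresentation _root_.ContinuousCohomology DiscreteGaloisModule
open LocalWeilDatum

/-! ### The unit-index formula for one local field -/

section Formula

variable (F : Type) [Field F] [ValuativeRel F] [TopologicalSpace F] [IsNonarchimedeanLocalField F]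
  [CharZero F]

omit [ValuativeRel F] [TopologicalSpace F] [IsNonarchimedeanLocalField F] in
/-- `#H¹(F, μ_N) = #(Fˣ/Fˣᴺ)` (Kummer theory, the tree's `kummerEquiv`).
[cite: SerreGaloisCohomology1997, II §1.2] -/
theorem natCard_continuousCohomology_one_mu_eq (N : ℕ) [NeZero N] :
    Nat.card (continuousCohomology 1 (mu F N).toTopRep) =
      Nat.card (Fˣ ⧸ (powMonoidHom N : Fˣ →* Fˣ).range) := by
  haveI : NeZero ((N : ℕ) : F) := NeZero.charZero
  exact (Nat.card_congr (kummerEquiv F N).toEquiv).trans (Nat.card_congr Additive.toMul)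

/-- **The local unit-index formula** (Neukirch, *ANT* II (5.8)): for a non-archimedean local field `F`
of characteristic `0` and `N ≥ 1`, GIVEN Tate's local Euler–Poincaré characteristic for `F` (`hEP`),

  `#(Fˣ / Fˣᴺ) = #μ_N(F) · N · #(𝒪[F] ⧸ N𝒪[F])`.

Proof: `hEP` at the module `μ_N(F̄)` (of order `N`) reads `#H⁰ · #H² · #(𝒪/N) = #H¹`, with
`#H⁰ = #μ_N(F)` (`natCard_invariants_mu`), `#H² = N` (the tree's `natCard_two_mu_absoluteGaloisGroup_eq`) and
`#H¹ = #(Fˣ/Fˣᴺ)` (Kummer). [cite: NeukirchANT1999, Ch. II §5 Cor. (5.8)]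
[cite: MilneADT2006, Ch. I §2 Thm. 2.8] -/
theorem natCard_units_quot_range_pow_eq_of_localEP (hEP : localEulerPoincareCharacteristic F)
    (N : ℕ) [NeZero N] :
    Nat.card (Fˣ ⧸ (powMonoidHom N : Fˣ →* Fˣ).range) =
      Nat.card (rootsOfUnity N F) * N * Nat.card (𝒪[F] ⧸ Ideal.span {((N : ℕ) : 𝒪[F])}) := by
  haveI : Finite (MuCarrier F N) := finite_muCarrier F N
  have hμ : Nat.card (MuCarrier F N) = N := by
    change Nat.card (rootsOfUnity N (AlgebraicClosure F)) = N
    exact HasEnoughRootsOfUnity.natCard_rootsOfUnity _ N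
  obtain ⟨-, -, heq⟩ := hEP (mu F N)
  rw [hμ, natCard_invariants_mu F N, natCard_two_mu_absoluteGaloisGroup_eq F N,
    natCard_continuousCohomology_one_mu_eq F N] at heq
  exact heq.symm

omit [CharZero F] in
/-- `𝒪[F] ⧸ c𝒪[F]` is finite for `c ≠ 0` (`c𝒪 = 𝔪ᵏ` in the discrete valuation ring `𝒪[F]`, and the
residue field is finite; Serre, *Corps locaux* II §1 Prop. 1: a locally compact valued field has
finite residue field, whence finite `𝒪/𝔪ᵏ`). [cite: SerreLocalFields1979, Ch. II §1 Prop. 1] -/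
theorem finite_integer_quot_span_singleton {c : 𝒪[F]} (hc : c ≠ 0) :
    Finite (𝒪[F] ⧸ Ideal.span {c}) := by
  haveI : Finite (𝒪[F] ⧸ IsLocalRing.maximalIdeal 𝒪[F]) := inferInstanceAs (Finite 𝓀[F])
  obtain ⟨π, hπ⟩ := IsDiscreteValuationRing.exists_irreducible 𝒪[F]
  have hs : Ideal.span {c} ≠ ⊥ := by rwa [Ne, Ideal.span_singleton_eq_bot]
  obtain ⟨k, hk⟩ := IsDiscreteValuationRing.ideal_eq_span_pow_irreducible hs hπ
  rw [hk, ← Ideal.span_singleton_pow, ← hπ.maximalIdeal_eq]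
  exact Ideal.finite_quotient_pow (IsNoetherian.noetherian _) k

omit [TopologicalSpace F] [IsNonarchimedeanLocalField F] in
/-- `(N : 𝒪[F]) ≠ 0` for `N ≠ 0` (characteristic `0`). [folklore] -/
private theorem natCast_integer_ne_zero' {N : ℕ} (hN : N ≠ 0) : ((N : ℕ) : 𝒪[F]) ≠ 0 := by
  intro h
  have h' : (((N : ℕ) : 𝒪[F]) : F) = 0 := by rw [h]; rfl
  have : ((N : ℕ) : F) = 0 := by exact_mod_cast h'
  exact hN (Nat.cast_eq_zero.mp this)

/-- `#(Fˣ/Fˣᴺ)` is finite and non-zero (`N ≥ 1`, characteristic `0`): the tree's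
`finite_quotient_range_powMonoidHom_units`, here read off the formula; Serre, *Cohomologie
galoisienne* II §5.1 (a): "les quotients `k*/k*ⁿ` sont finis pour tout `n ≥ 1`").
[cite: SerreGaloisCohomology1997, II §5.1 (a)] -/
theorem natCard_units_quot_range_pow_ne_zero (hEP : localEulerPoincareCharacteristic F) (N : ℕ)
    [NeZero N] : Nat.card (Fˣ ⧸ (powMonoidHom N : Fˣ →* Fˣ).range) ≠ 0 := by
  rw [natCard_units_quot_range_pow_eq_of_localEP F hEP N]
  haveI : Finite (𝒪[F] ⧸ Ideal.span {((N : ℕ) : 𝒪[F])}) :=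
    finite_integer_quot_span_singleton F (natCast_integer_ne_zero' F (NeZero.ne N))
  exact mul_ne_zero (mul_ne_zero Nat.card_pos.ne' (NeZero.ne N)) Nat.card_pos.ne'

end Formula

/-! ### Monotonicity in a finite extension `E ≤ M` inside `K̄` -/

section Monotone

variable (K : Type) [Field K] [ValuativeRel K] [TopologicalSpace K] [IsNonarchimedeanLocalField K]
  [CharZero K] {E M : IntermediateField K (AlgebraicClosure K)} (N : ℕ) [NeZero N]

omit [ValuativeRel K] [TopologicalSpace K] [IsNonarchimedeanLocalField K] [CharZero K] in
/-- `#μ_N(E) ≤ #μ_N(M)` for `E ≤ M` (roots of unity of `E` are roots of unity of `M`). [folklore] -/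
private theorem natCard_rootsOfUnity_le_of_le (h : E ≤ M) :
    Nat.card (rootsOfUnity N E) ≤ Nat.card (rootsOfUnity N M) := by
  let ι : Eˣ →* Mˣ := Units.map (IntermediateField.inclusion h).toMonoidHom
  have hι : Function.Injective ι := fun a b hab => by
    apply Units.ext
    apply (IntermediateField.inclusion h).injective
    exact congrArg (fun u : Mˣ => (u : M)) hab
  refine Nat.card_le_card_of_injective
    (fun ζ : rootsOfUnity N E => (⟨ι ζ.1, ?_⟩ : rootsOfUnity N M)) ?_
  · rw [mem_rootsOfUnity, ← map_pow, (mem_rootsOfUnity N (ζ : Eˣ)).1 ζ.2, map_one]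
  · rintro ⟨a, ha⟩ ⟨b, hb⟩ hab
    simp only [Subtype.mk.injEq] at hab
    exact Subtype.ext (hι hab)

omit [CharZero K] [NeZero N] in
/-- `𝒪[E] = 𝒪[M] ∩ E` for the prolonged valuations: `x ∈ 𝒪[E] ↔ x ∈ 𝒪[M]` for `x : E` (both mean
"`x` is integral over `𝒪[K]`", `FiniteExtension.mem_integer_iff_isIntegral`).
[cite: SerreLocalFields1979, Ch. II §2 Prop. 3] -/
theorem mem_integer_inclusion_iff (h : E ≤ M) [FiniteDimensional K E] [FiniteDimensional K M] (x : E) :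
    letI := FiniteExtension.valuativeRel K E
    letI := FiniteExtension.valuativeRel K M
    IntermediateField.inclusion h x ∈ 𝒪[M] ↔ x ∈ 𝒪[E] := by
  rw [FiniteExtension.mem_integer_iff_isIntegral K M, FiniteExtension.mem_integer_iff_isIntegral K E]
  exact isIntegral_algHom_iff ((IntermediateField.inclusion h).restrictScalars 𝒪[K])
    (IntermediateField.inclusion h).injective

/-- `#(𝒪[E] ⧸ N𝒪[E]) ≤ #(𝒪[M] ⧸ N𝒪[M])` for `E ≤ M`: the inclusion induces an INJECTION
`𝒪[E]/N ↪ 𝒪[M]/N`, since `N𝒪[M] ∩ E = N𝒪[E]` (`x = Ny` with `y ∈ 𝒪[M]` forces `y = x/N ∈ E ∩ 𝒪[M] = 𝒪[E]`).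
[cite: NeukirchANT1999, Ch. II §5 Cor. (5.8)] -/
theorem natCard_integer_quot_le_of_le (h : E ≤ M) [FiniteDimensional K E] [FiniteDimensional K M] :
    letI := FiniteExtension.valuativeRel K E
    letI := FiniteExtension.valuativeRel K M
    Nat.card (𝒪[E] ⧸ Ideal.span {((N : ℕ) : 𝒪[E])}) ≤ Nat.card (𝒪[M] ⧸ Ideal.span {((N : ℕ) : 𝒪[M])}) := by
  letI := FiniteExtension.valuativeRel K M
  letI := FiniteExtension.topologicalSpace K M
  haveI : IsNonarchimedeanLocalField M := FiniteExtension.isNonarchimedeanLocalField K M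
  letI := FiniteExtension.valuativeRel K E
  haveI : Finite (𝒪[M] ⧸ Ideal.span {((N : ℕ) : 𝒪[M])}) :=
    finite_integer_quot_span_singleton M (natCast_integer_ne_zero' M (NeZero.ne N))
  -- the ring map `𝒪[E] → 𝒪[M]`
  let φ : 𝒪[E] →+* 𝒪[M] :=
    { toFun := fun x => ⟨IntermediateField.inclusion h x, (mem_integer_inclusion_iff K h x.1).mpr x.2⟩
      map_one' := Subtype.ext (map_one _)
      map_mul' := fun x y => Subtype.ext (map_mul _ _ _)
      map_zero' := Subtype.ext (map_zero _)
      map_add' := fun x y => Subtype.ext (map_add _ _ _) }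
  have hφN : φ ((N : ℕ) : 𝒪[E]) = ((N : ℕ) : 𝒪[M]) := map_natCast φ N
  have hle : Ideal.span {((N : ℕ) : 𝒪[E])} ≤ (Ideal.span {((N : ℕ) : 𝒪[M])}).comap φ := by
    rw [Ideal.span_singleton_le_iff_mem, Ideal.mem_comap, hφN]
    exact Ideal.mem_span_singleton_self _
  refine Nat.card_le_card_of_injective (Ideal.quotientMap _ φ hle) ?_
  rw [injective_iff_map_eq_zero]
  intro z hz
  obtain ⟨x, rfl⟩ := Ideal.Quotient.mk_surjective z
  rw [Ideal.quotientMap_mk, Ideal.Quotient.eq_zero_iff_mem, Ideal.mem_span_singleton] at hz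
  obtain ⟨y, hy⟩ := hz
  rw [Ideal.Quotient.eq_zero_iff_mem, Ideal.mem_span_singleton]
  -- `y = φ (x / N)` and `x / N ∈ 𝒪[E]`
  have hN0 : ((N : ℕ) : E) ≠ 0 := Nat.cast_ne_zero.mpr (NeZero.ne N)
  set w : E := (x : E) / (N : ℕ) with hw
  have hwx : (x : E) = (N : ℕ) * w := by rw [hw, mul_div_cancel₀ _ hN0]
  have hφx : ((φ x : 𝒪[M]) : M) = IntermediateField.inclusion h (x : E) := rfl
  have hyw : (y : M) = IntermediateField.inclusion h w := by
    have h1 : ((φ x : 𝒪[M]) : M) = (N : ℕ) * (y : M) := by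
      rw [hy]; push_cast; rfl
    rw [hφx, hwx, map_mul, map_natCast] at h1
    exact (mul_left_cancel₀ (Nat.cast_ne_zero.mpr (NeZero.ne N)) h1).symm
  have hwO : w ∈ 𝒪[E] := by
    rw [← mem_integer_inclusion_iff K h, ← hyw]
    exact y.2
  refine ⟨⟨w, hwO⟩, Subtype.ext ?_⟩
  push_cast
  exact hwx

/-- **Monotonicity of the unit index in a finite extension of `p`-adic fields**: for a
non-archimedean local field `K` of characteristic `0`, finite subextensions `E ≤ M` of `K̄/K` and
`N ≥ 1`, GIVEN Tate's local Euler–Poincaré characteristic for every `p`-adic field (`hEP`),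

  `#(Eˣ / Eˣᴺ) ≤ #(Mˣ / Mˣᴺ)`

— termwise from the unit-index formula `#(Fˣ/Fˣᴺ) = #μ_N(F) · N · #(𝒪_F/N)` at the local fields
`E`, `M` (extended valuations `FiniteExtension.valuativeRel K _`). The statement itself mentions no
valuation. [cite: NeukirchANT1999, Ch. II §5 Cor. (5.8)] -/
theorem natCard_units_quot_range_pow_le_of_le (h : E ≤ M)
    (hEP : ∀ (F : Type) [Field F] [ValuativeRel F] [TopologicalSpace F] [IsNonarchimedeanLocalField F]
      [CharZero F], localEulerPoincareCharacteristic F)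
    [FiniteDimensional K E] [FiniteDimensional K M] :
    Nat.card (Eˣ ⧸ (powMonoidHom N : Eˣ →* Eˣ).range) ≤
      Nat.card (Mˣ ⧸ (powMonoidHom N : Mˣ →* Mˣ).range) := by
  letI := FiniteExtension.valuativeRel K M
  letI := FiniteExtension.topologicalSpace K M
  haveI : IsNonarchimedeanLocalField M := FiniteExtension.isNonarchimedeanLocalField K M
  letI := FiniteExtension.valuativeRel K E
  letI := FiniteExtension.topologicalSpace K E
  haveI : IsNonarchimedeanLocalField E := FiniteExtension.isNonarchimedeanLocalField K E
  rw [natCard_units_quot_range_pow_eq_of_localEP E (hEP E) N,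
    natCard_units_quot_range_pow_eq_of_localEP M (hEP M) N]
  exact Nat.mul_le_mul (Nat.mul_le_mul (natCard_rootsOfUnity_le_of_le K N h) le_rfl)
    (natCard_integer_quot_le_of_le K N h)

/-- The finiteness companion: `#(Mˣ/Mˣᴺ) ≠ 0` for a finite subextension `M` of `K̄/K` (Serre,
*Cohomologie galoisienne* II §5.1 (a), at the local field `M`). [cite: SerreGaloisCohomology1997, II §5.1 (a)] -/
theorem natCard_units_quot_range_pow_ne_zero_of_intermediateField
    (hEP : ∀ (F : Type) [Field F] [ValuativeRel F] [TopologicalSpace F] [IsNonarchimedeanLocalField F]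
      [CharZero F], localEulerPoincareCharacteristic F)
    (M : IntermediateField K (AlgebraicClosure K)) [FiniteDimensional K M] :
    Nat.card (Mˣ ⧸ (powMonoidHom N : Mˣ →* Mˣ).range) ≠ 0 := by
  letI := FiniteExtension.valuativeRel K M
  letI := FiniteExtension.topologicalSpace K M
  haveI : IsNonarchimedeanLocalField M := FiniteExtension.isNonarchimedeanLocalField K M
  exact natCard_units_quot_range_pow_ne_zero M (hEP M) N

end Monotone

end Literature.NumberTheory.GaloisRepresentations

end
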